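import Summits.HubbardSuperconductivity.HubbardSuperconductivity.Theorems.AnisotropyChordStiffnessCurrentElements
import Summits.HubbardSuperconductivity.HubbardSuperconductivity.Theorems.AnisotropyChordStiffnessKernelSymmetric
import Summits.HubbardSuperconductivity.HubbardSuperconductivity.Theorems.AnisotropyChordStiffnessDiamagnetic
import Summits.HubbardSuperconductivity.HubbardSuperconductivity.Theorems.AnisotropyChordInsertionEntropyUniformDensity

/-!
# Route `AnisotropyChord` / H0 rotor rung: REFLECTION COVARIANCE of the hard-core boson torus (toolkit for the
# reduction of the helicity TENSOR hypothesis (S_Υ) to per-axis twist stiffness, theory seat memo ROTOR-THEORY-8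
# §118 (D2) / §124 work-order W10)

Site relabellings `R : (ℤ/L)² ≃ (ℤ/L)²` act on state vectors by pull-back `configPull R v = v ∘ (· ∘ R)`.  This file
proves, for graph automorphisms `φ` of the torus and the axis reflection `axisFlip` (`(x₀,x₁) ↦ (x₀,−x₁)`):
* `dotProduct_configPull` (unitarity), `configPull_toC_perron` (Perron amplitudes are invariant, tree
  `perronAmplitude_comp_iso`), `hcb_mulVec_configPull` / `aeval_mulVec_configPull` (`H(Δ)` and every polynomial in it
  commute with the pull-back, tree `xxz_mulVec_comp_iso`);
* `configPull_bondCurrent_mulVec` (`Θ_R j_{xy} = j_{Rx,Ry} Θ_R`), `bondCurrent_mulVec_swap` (`j_{yx} = −j_{xy}`);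
* `axisFlipIso` (the reflection is a torus automorphism) and the two covariance laws of the uniform currents:
  **`configPull_currentMode_axis0`** (`Θ J⁰_0 = J⁰_0 Θ`) and **`configPull_currentMode_axis1`** (`Θ J¹_0 = −J¹_0 Θ`).
-/

set_option linter.dupNamespace false

noncomputable section

open Matrix Complex Finset Polynomial
open scoped ComplexConjugate
open Literature.MathematicalPhysics.QuantumLattice hiding torusPhase torusNorm
open Literature.Probability.LatticeModels
open Summit.HubbardSuperconductivity.HubbardSuperconductivity.Theorems.AnisotropyChord.InsertionEntropy

namespace Summit.HubbardSuperconductivity.HubbardSuperconductivity.Theorems.AnisotropyChord.Stiffness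

variable {L : ℕ} [NeZero L]

/-! ## Pull-back of state vectors along a site relabelling -/

/-- Pull-back of a state vector along a site relabelling `R`: `(Θ_R v)(σ) = v(σ ∘ R)` (a permutation of the
configuration basis, hence unitary). [folklore] -/
def configPull (R : TorusSite 2 L ≃ TorusSite 2 L) (v : TensorIndex (TorusSite 2 L) 2 → ℂ) :
    TensorIndex (TorusSite 2 L) 2 → ℂ :=
  fun σ => v (σ ∘ R)

omit [NeZero L] in
/-- `Θ_R` is additive. [folklore] -/
theorem configPull_add (R : TorusSite 2 L ≃ TorusSite 2 L) (u w : TensorIndex (TorusSite 2 L) 2 → ℂ) :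
    configPull R (u + w) = configPull R u + configPull R w := rfl

omit [NeZero L] in
/-- `Θ_R` commutes with scalars. [folklore] -/
theorem configPull_smul (R : TorusSite 2 L ≃ TorusSite 2 L) (c : ℂ) (u : TensorIndex (TorusSite 2 L) 2 → ℂ) :
    configPull R (c • u) = c • configPull R u := rfl

omit [NeZero L] in
/-- `Θ_R` commutes with negation. [folklore] -/
theorem configPull_neg (R : TorusSite 2 L ≃ TorusSite 2 L) (u : TensorIndex (TorusSite 2 L) 2 → ℂ) :
    configPull R (-u) = -configPull R u := rfl

omit [NeZero L] in
/-- `Θ_R` commutes with finite sums. [folklore] -/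
theorem configPull_sum {ι : Type*} (R : TorusSite 2 L ≃ TorusSite 2 L) (s : Finset ι)
    (f : ι → TensorIndex (TorusSite 2 L) 2 → ℂ) :
    configPull R (∑ i ∈ s, f i) = ∑ i ∈ s, configPull R (f i) := by
  funext σ
  unfold configPull
  simp only [Finset.sum_apply]

/-- **`Θ_R` is unitary:** `⟨Θ_R u, Θ_R w⟩ = ⟨u, w⟩`. [folklore] -/
theorem dotProduct_configPull (R : TorusSite 2 L ≃ TorusSite 2 L) (u w : TensorIndex (TorusSite 2 L) 2 → ℂ) :
    star (configPull R u) ⬝ᵥ configPull R w = star u ⬝ᵥ w := by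
  unfold configPull dotProduct
  exact sum_config_comp_equiv R (fun τ => star (u τ) * w τ)

/-- **Perron amplitudes are invariant under torus automorphisms** (tree `perronAmplitude_comp_iso`). [folklore] -/
theorem configPull_toC_perron (Δ M : ℝ) (a : TensorIndex (TorusSite 2 L) 2 → ℝ)
    (ha : IsPerronSectorGroundAmplitude L Δ M a) (φ : torusGraph 2 L ≃g torusGraph 2 L) :
    configPull φ.toEquiv (toC L a) = toC L a := by
  funext σ
  unfold configPull toC
  rw [show (σ ∘ ⇑φ.toEquiv) = (σ ∘ ⇑φ) from rfl, perronAmplitude_comp_iso L Δ M a ha φ σ]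

/-- **`H(Δ)` commutes with the pull-back along a torus automorphism** (tree `xxz_mulVec_comp_iso`). [folklore] -/
theorem hcb_mulVec_configPull (Δ : ℝ) (φ : torusGraph 2 L ≃g torusGraph 2 L)
    (v : TensorIndex (TorusSite 2 L) 2 → ℂ) :
    hcbHamiltonian L Δ *ᵥ configPull φ.toEquiv v = configPull φ.toEquiv (hcbHamiltonian L Δ *ᵥ v) := by
  funext σ
  exact xxz_mulVec_comp_iso (torusGraph 2 L) Δ φ v σ

/-- Powers of `H(Δ)` commute with the pull-back. [folklore] -/
theorem pow_mulVec_configPull (Δ : ℝ) (φ : torusGraph 2 L ≃g torusGraph 2 L) (n : ℕ)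
    (v : TensorIndex (TorusSite 2 L) 2 → ℂ) :
    (hcbHamiltonian L Δ) ^ n *ᵥ configPull φ.toEquiv v = configPull φ.toEquiv ((hcbHamiltonian L Δ) ^ n *ᵥ v) := by
  induction n generalizing v with
  | zero => simp
  | succ n ih =>
      rw [pow_succ, ← mulVec_mulVec, ← mulVec_mulVec, hcb_mulVec_configPull, ih]

/-- **Every polynomial in `H(Δ)` commutes with the pull-back along a torus automorphism.** [folklore] -/
theorem aeval_mulVec_configPull (Δ : ℝ) (φ : torusGraph 2 L ≃g torusGraph 2 L) (p : ℂ[X])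
    (v : TensorIndex (TorusSite 2 L) 2 → ℂ) :
    aeval (hcbHamiltonian L Δ) p *ᵥ configPull φ.toEquiv v
      = configPull φ.toEquiv (aeval (hcbHamiltonian L Δ) p *ᵥ v) := by
  induction p using Polynomial.induction_on' generalizing v with
  | add p q hp hq => rw [map_add, add_mulVec, add_mulVec, hp, hq, configPull_add]
  | monomial n c =>
      rw [Polynomial.aeval_monomial, Algebra.algebraMap_eq_smul_one, smul_mul_assoc, one_mul,
        Matrix.smul_mulVec, Matrix.smul_mulVec, pow_mulVec_configPull, configPull_smul]

/-! ## Bond currents under relabellings -/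

/-- **Covariance of the bond current:** `Θ_R (j_{xy} v) = j_{Rx,Ry} (Θ_R v)` (`x ≠ y`). [folklore] -/
theorem configPull_bondCurrent_mulVec (R : TorusSite 2 L ≃ TorusSite 2 L) {x y : TorusSite 2 L} (hxy : x ≠ y)
    (v : TensorIndex (TorusSite 2 L) 2 → ℂ) :
    configPull R (bondCurrent L x y *ᵥ v) = bondCurrent L (R x) (R y) *ᵥ configPull R v := by
  have hR : R x ≠ R y := fun h => hxy (R.injective h)
  funext σ
  have hswap : (σ ∘ ⇑R) ∘ ⇑(Equiv.swap x y) = (σ ∘ ⇑(Equiv.swap (R x) (R y))) ∘ ⇑R := by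
    funext z
    simp only [Function.comp_apply]
    rw [R.injective.map_swap]
  simp only [configPull, bondCurrent_mulVec_apply hxy, bondCurrent_mulVec_apply hR, hswap, Function.comp_apply]

/-- **Antisymmetry of the bond current:** `j_{yx} v = −j_{xy} v` (`x ≠ y`). [folklore] -/
theorem bondCurrent_mulVec_swap {x y : TorusSite 2 L} (hxy : x ≠ y) (v : TensorIndex (TorusSite 2 L) 2 → ℂ) :
    bondCurrent L y x *ᵥ v = -(bondCurrent L x y *ᵥ v) := by
  funext σ
  rw [Pi.neg_apply, bondCurrent_mulVec_apply hxy.symm, bondCurrent_mulVec_apply hxy, Equiv.swap_comm]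
  have fin2 : ∀ t : Fin 2, t = 0 ∨ t = 1 := by decide
  rcases fin2 (σ x) with hx | hx <;> rcases fin2 (σ y) with hy | hy <;> simp [hx, hy]

/-! ## The axis reflection `(x₀, x₁) ↦ (x₀, −x₁)` -/

/-- The reflection of the second axis, `(x₀, x₁) ↦ (x₀, −x₁)`, as a bijection of `(ℤ/L)²`. [folklore] -/
def axisFlip (L : ℕ) [NeZero L] : TorusSite 2 L ≃ TorusSite 2 L where
  toFun x := Function.update x 1 (-(x 1))
  invFun x := Function.update x 1 (-(x 1))
  left_inv x := by
    simp only [Function.update_self, neg_neg, Function.update_idem, Function.update_eq_self]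
  right_inv x := by
    simp only [Function.update_self, neg_neg, Function.update_idem, Function.update_eq_self]

/-- `axisFlip` in coordinates. [folklore] -/
theorem axisFlip_apply (x : TorusSite 2 L) (i : Fin 2) :
    axisFlip L x i = if i = 1 then -(x 1) else x i := by
  show Function.update x 1 (-(x 1)) i = _
  by_cases h : i = 1
  · subst h; simp
  · rw [Function.update_of_ne h, if_neg h]

/-- `axisFlip` is additive. [folklore] -/
theorem axisFlip_add (x y : TorusSite 2 L) : axisFlip L (x + y) = axisFlip L x + axisFlip L y := by
  funext i
  rw [Pi.add_apply, axisFlip_apply, axisFlip_apply, axisFlip_apply]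
  by_cases h : i = 1
  · subst h; simp only [↓reduceIte, Pi.add_apply, neg_add]
  · simp [h]

/-- `axisFlip` fixes the first unit vector. [folklore] -/
theorem axisFlip_single_zero : axisFlip L (Pi.single 0 1) = Pi.single 0 1 := by
  funext i
  rw [axisFlip_apply]
  by_cases h : i = 1
  · subst h; simp
  · simp [h]

/-- `axisFlip` negates the second unit vector. [folklore] -/
theorem axisFlip_single_one : axisFlip L (Pi.single 1 1) = -Pi.single 1 1 := by
  funext i
  rw [axisFlip_apply]
  by_cases h : i = 1
  · subst h; simp
  · simp [h]

/-- `axisFlip` is an involution. [folklore] -/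
theorem axisFlip_axisFlip (x : TorusSite 2 L) : axisFlip L (axisFlip L x) = x :=
  (axisFlip L).left_inv x

/-- `axisFlip` maps direction-`0` steps to direction-`0` steps and direction-`1` steps to reversed direction-`1`
steps. [folklore] -/
theorem axisFlip_add_single (x : TorusSite 2 L) (i : Fin 2) :
    axisFlip L (x + Pi.single i 1)
      = if i = 1 then axisFlip L x - Pi.single 1 1 else axisFlip L x + Pi.single 0 1 := by
  have fin2 : i = 0 ∨ i = 1 := by
    rcases Fin.exists_fin_two.mp ⟨i, rfl⟩ with h | h <;> simp [h]
  rcases fin2 with h | h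
  · subst h; rw [if_neg (by decide), axisFlip_add, axisFlip_single_zero]
  · subst h; rw [if_pos rfl, axisFlip_add, axisFlip_single_one, sub_eq_add_neg]

/-- Adjacency of the torus is preserved by `axisFlip` (one direction). [folklore] -/
theorem torusGraph_adj_axisFlip {x y : TorusSite 2 L} (h : (torusGraph 2 L).Adj x y) :
    (torusGraph 2 L).Adj (axisFlip L x) (axisFlip L y) := by
  rw [torusGraph_adj_iff] at h ⊢
  obtain ⟨hne, hor⟩ := h
  refine ⟨fun heq => hne ((axisFlip L).injective heq), ?_⟩
  rcases hor with ⟨i, hi⟩ | ⟨i, hi⟩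
  · rw [hi, axisFlip_add_single]
    by_cases h1 : i = 1
    · rw [if_pos h1]
      exact Or.inr ⟨1, by rw [sub_add_cancel]⟩
    · rw [if_neg h1]
      exact Or.inl ⟨0, rfl⟩
  · rw [hi, axisFlip_add_single]
    by_cases h1 : i = 1
    · rw [if_pos h1]
      exact Or.inl ⟨1, by rw [sub_add_cancel]⟩
    · rw [if_neg h1]
      exact Or.inr ⟨0, rfl⟩

/-- **The axis reflection is an automorphism of the torus graph.** [folklore] -/
def axisFlipIso (L : ℕ) [NeZero L] : torusGraph 2 L ≃g torusGraph 2 L where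
  toEquiv := axisFlip L
  map_rel_iff' := by
    intro x y
    constructor
    · intro h
      have h2 := torusGraph_adj_axisFlip h
      rw [axisFlip_axisFlip, axisFlip_axisFlip] at h2
      exact h2
    · exact torusGraph_adj_axisFlip

/-- The underlying bijection of `axisFlipIso` is `axisFlip`. [folklore] -/
theorem axisFlipIso_toEquiv : (axisFlipIso L).toEquiv = axisFlip L := rfl

/-! ## The uniform currents under the axis reflection -/

/-- At zero momentum the current mode is the plain sum of bond currents. [folklore] -/
theorem currentMode_zero_mulVec (j : Fin 2) (v : TensorIndex (TorusSite 2 L) 2 → ℂ) :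
    currentMode L 0 j *ᵥ v = ∑ x : TorusSite 2 L, bondCurrent L x (x + Pi.single j 1) *ᵥ v := by
  unfold currentMode
  rw [Matrix.sum_mulVec]
  refine Finset.sum_congr rfl fun x _ => ?_
  rw [InsertionEntropy.torusPhase_zero_left, one_smul]

/-- **`Θ J⁰_0 = J⁰_0 Θ`:** the uniform current ALONG the mirror axis is reflection-even. [folklore] -/
theorem configPull_currentMode_axis0 (hL : 2 ≤ L) (v : TensorIndex (TorusSite 2 L) 2 → ℂ) :
    configPull (axisFlip L) (currentMode L 0 0 *ᵥ v) = currentMode L 0 0 *ᵥ configPull (axisFlip L) v := by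
  rw [currentMode_zero_mulVec, currentMode_zero_mulVec, configPull_sum]
  have hterm : ∀ x : TorusSite 2 L, configPull (axisFlip L) (bondCurrent L x (x + Pi.single 0 1) *ᵥ v)
      = bondCurrent L (axisFlip L x) (axisFlip L x + Pi.single 0 1) *ᵥ configPull (axisFlip L) v := by
    intro x
    rw [configPull_bondCurrent_mulVec (axisFlip L) (add_single_ne_self hL x 0).symm, axisFlip_add_single,
      if_neg (by decide)]
  rw [Finset.sum_congr rfl fun x _ => hterm x]
  exact Fintype.sum_equiv (axisFlip L) _ _ (fun x => rfl)

/-- **`Θ J¹_0 = −J¹_0 Θ`:** the uniform current ACROSS the mirror axis is reflection-odd. [folklore] -/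
theorem configPull_currentMode_axis1 (hL : 2 ≤ L) (v : TensorIndex (TorusSite 2 L) 2 → ℂ) :
    configPull (axisFlip L) (currentMode L 0 1 *ᵥ v) = -(currentMode L 0 1 *ᵥ configPull (axisFlip L) v) := by
  rw [currentMode_zero_mulVec, currentMode_zero_mulVec, configPull_sum]
  have hne : ∀ y : TorusSite 2 L, y - Pi.single 1 1 ≠ y := by
    intro y h
    have := add_single_ne_self hL (y - Pi.single 1 1) 1
    rw [sub_add_cancel] at this
    exact this h.symm
  -- step 1: transport each bond current through the reflection
  have h1 : ∀ x : TorusSite 2 L, configPull (axisFlip L) (bondCurrent L x (x + Pi.single 1 1) *ᵥ v)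
      = bondCurrent L (axisFlip L x) (axisFlip L x - Pi.single 1 1) *ᵥ configPull (axisFlip L) v := by
    intro x
    rw [configPull_bondCurrent_mulVec (axisFlip L) (add_single_ne_self hL x 1).symm, axisFlip_add_single,
      if_pos rfl]
  rw [Finset.sum_congr rfl fun x _ => h1 x]
  -- step 2: reindex by the reflection
  have h2 : ∑ x : TorusSite 2 L, bondCurrent L (axisFlip L x) (axisFlip L x - Pi.single 1 1) *ᵥ configPull (axisFlip L) v
      = ∑ y : TorusSite 2 L, bondCurrent L y (y - Pi.single 1 1) *ᵥ configPull (axisFlip L) v :=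
    Fintype.sum_equiv (axisFlip L) _ _ (fun x => rfl)
  rw [h2]
  -- step 3: antisymmetry of each bond current
  have h3 : ∀ y : TorusSite 2 L, bondCurrent L y (y - Pi.single 1 1) *ᵥ configPull (axisFlip L) v
      = -(bondCurrent L (y - Pi.single 1 1) y *ᵥ configPull (axisFlip L) v) := fun y => bondCurrent_mulVec_swap (hne y) _
  rw [Finset.sum_congr rfl fun y _ => h3 y, Finset.sum_neg_distrib]
  refine congrArg Neg.neg ?_
  -- step 4: reindex `y = z + e₁`
  symm
  exact Fintype.sum_equiv (Equiv.addRight (Pi.single 1 1)) _ _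
    (fun z => by simp only [Equiv.coe_addRight, add_sub_cancel_right])

end Summit.HubbardSuperconductivity.HubbardSuperconductivity.Theorems.AnisotropyChord.Stiffness
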